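import Literature.NumberTheory.Automorphic.Liu2021.AlbaneseBaseChangeFiniteGalois
import Literature.NumberTheory.Automorphic.Liu2021.AlbaneseMapEpiOfSurjective
import Literature.AlgebraicGeometry.Motives.GeneratesBaseChange
import Literature.AlgebraicGeometry.Motives.GeneratesHomExtReduced
import Literature.AlgebraicGeometry.Motives.AlbaneseExistenceComplex
import Literature.AlgebraicGeometry.Motives.CurveLinearSystemMorphism
import Literature.AlgebraicGeometry.Motives.AlgPointsNonempty
import HarnessLib

/-!
# The Albanese morphism `α_X : ∇X → Alb_X` GENERATES `Alb_X` (Liu 2021, §2.1; Serre, no. 1–2; Lang II §3)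

Topic `Literature/NumberTheory/Automorphic/Liu2021`; generic lemmas in namespace `Literature.AlgebraicGeometry.Motives`,
head in `Literature.NumberTheory.Automorphic.Liu2021.AppendixC`.  PROOF FILE (theorems only; no definition, no named fact,
no instance, no `sorry`).  Cell `hodgecm-mathlib` (D-0151), FLOOR-0 P5a, pole of the D9op road 2′ (sub-line
`Cruxes/HLiu418/Lines/F0_D9opRoad2.lean`, item G1 of LEAD WORD #3a): input of T4 «generation spreads from the generic fibre
to every fibre of an abelian scheme» (★ `AbelianScheme.generates_fibre_of_generates_fibre_of_injective`) ON THE GENERIC FIBRE.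

For a morphism `φ : N → A` from a `K`-scheme to an abelian variety, `Generates φ` (★ `Motives/GeneratedAbelianSubvariety`,
Serre no. 1 Déf. 1, Lang II §3 p. 35) says that some sum map `s_n : (N × N)ⁿ⁺¹ → A`,
`((x_i, y_i))_i ↦ ∏ φ(x_i) φ(y_i)⁻¹`, is surjective.  For Liu's POINT-FREE Albanese datum `α_X : ∇X → Alb_X` of a smooth
projective `X` ([Liu2021] Def. 2.3, ★ `AppendixC.Albanese X`) this is NOT a case of the tree's ★ `Jacobian.generates_abelJacobi`
(Serre/Milne: the universal pointed morphism generates), because `∇X` is neither geometrically integral nor pointed when `X`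
is not geometrically connected (the record unitary Shimura curve `M⋆_K` has `pieces ≥ 1` complex components and no rational
point in general).  PROOF (ours, over the printed construction of `Alb_X`, [Liu2021] §2.1 proof of the Proposition,
l. 1194–1200: «`k'` splits `X` … `Alb_{X'} = ∏ᵢ Alb_{Xᵢ}` … Galois descent»):

* §1 **descent of generation along a field extension** — `Generates.of_baseChange : Generates (φ ×_K L) → Generates φ`
  (the sum maps of `φ_L` are the base changes of those of `φ` up to the monoidal structure isomorphisms — the
  plumbing of ★ `Motives/GeneratesBaseChange`, re-derived here because it is private there — and surjectivity DESCENDS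
  along the surjective projection `Y_L → Y`, [GortzWedhorn2020] Prop. 4.32 (2), Prop. 4.16);
* §2 **generation from a biproduct of generated pieces** (over an algebraically closed field `Ω`) —
  `generates_of_biproduct_charts`: if `A` carries a finite biproduct structure `π_c : A → J_c`, `ι_c : J_c → A`,
  `∑_c π_c ≫ ι_c = 𝟙`, and charts `l_c : S_c → N` with `l_c ≫ φ = ψ_c ≫ ι_c` where every `ψ_c : S_c → J_c` GENERATES, and
  `N` has an `Ω`-point, then `φ` generates: an `Ω`-point `x` of `A` is `∏_c ι_c(π_c x)`, each `π_c x` is a value of a sum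
  map of `ψ_c` (★ `AlgPoints.exists_comp_eq_of_surjective`), hence of `φ` (★ `exists_comp_pmSum_eq`, ★ `pmSum_comp`), products of
  values of sum maps are values of longer sum maps (`s_{n+1}(z,w) = s_n(z)·d(w)`), and a proper morphism onto whose image every
  `Ω`-point lifts is surjective (★ `SchemeOver.surjective_left_of_forall_algPoints`);
* §3 **the head** `Albanese.generates_α`: for `X` smooth of some relative dimension and projective over a field `k` of
  characteristic zero with `[Algebra k ℂ]`, non-empty, and ANY Albanese datum `a : Albanese X`, **`Generates a.α`** — by the
  α-COMPATIBLE finite-Galois fan ★ `Albanese.exists_isGalois_isLimit_fan_baseChange_compat` (`(Alb_X)_L ≅ ⊕_c J(E_c)` with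
  pointed pieces `E_c` and charts `E_c × E_c → (∇X)_L` along which `(α_X)_L` is `diff_c ≫ ι_c`), Milne's ★
  `Jacobian.generates_abelJacobi` (`diff_c` generates `J(E_c)`), §2 over `Ω = L̄`, and §1 twice (`Ω → L → k`).
  `Nonempty X` is necessary: for `X = ∅`, `∇X = ∅` and `Alb_X = 0` has one point.  The characteristic-zero/`ℂ` hypotheses are
  those of the fan theorem (the tree's existence road for `Alb_X`); the consumer is the generic fibre `M⋆_K / F` of the record curve.

HC_CM is proved only modulo the 7 printed citations until rung 0 closes; nothing of [Liu2021] is asserted here.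

## References
* [Liu2021] Y. Liu, *Fourier–Jacobi cycles and arithmetic relative trace formula*, Camb. J. Math. 9 (2021) = arXiv:2102.11518:
  §2.1 Def. 2.1 (1) (FJcycle.tex l. 1171–1174), Proposition (l. 1190–1192) with proof (l. 1194–1200), Def. 2.3 (l. 1202–1208).
* [Serre1958MorphismesUniversels] J.-P. Serre, *Morphismes universels et variété d'Albanese*, Sém. Chevalley 4 (1958/59), exp. 10,
  no. 1 (Déf. 1, the maps `f_n`), no. 2 Thm. 1–2.
* [Lang1983AbelianVarieties] S. Lang, *Abelian Varieties* (1959/1983), II §3 (p. 35: generation; Thm. 10–11).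
* [Milne1986JacobianVarieties] J. S. Milne, *Jacobian Varieties* (Cornell–Silverman 1986), §6 Prop. 6.1 (proof: «`f^P(C)` generates `J`»),
  Prop. 6.4, Remark 6.5.
* [GortzWedhorn2020] U. Görtz, T. Wedhorn, *Algebraic Geometry I*, 2nd ed. (2020), Prop. 4.16, (4.7), Prop. 4.32 (2), Prop. 3.35/Cor. 3.36.
-/

set_option autoImplicit false

noncomputable section

universe u

open CategoryTheory CategoryTheory.Limits AlgebraicGeometry MonoidalCategory CartesianMonoidalCategory

/-! ## §1 Descent of generation along a field extension -/

namespace Literature.AlgebraicGeometry.Motives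

open scoped MonObj Obj
open AbelianVariety (bcSpec bcFunctor)

section Descent

variable {K : Type u} [Field K] (L : Type u) [Field L] [Algebra K L]

/-- `Spec L → Spec K` is surjective (both spectra are points). [folklore] -/
private theorem surjective_bcSpec : Surjective (bcSpec K L) := by
  refine ⟨fun x => ?_⟩
  obtain ⟨y⟩ := (inferInstance : Nonempty (Spec (.of L)))
  exact ⟨y, Subsingleton.elim _ _⟩

/-- **Surjectivity descends along extension of the base field**: if `g_L : X_L → Y_L` is surjective then so is `g : X → Y`
(`g_L ≫ pr_Y = pr_X ≫ g` with `pr_Y : Y_L → Y` surjective). [cite: GortzWedhorn2020, Prop. 4.32 (2) and Prop. 4.16] -/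
theorem surjective_of_surjective_bcFunctor_map_left {X Y : SchemeOver K} (g : X ⟶ Y)
    [Surjective ((bcFunctor K L).map g).left] : Surjective g.left := by
  have hsq : ((bcFunctor K L).map g).left ≫ pullback.fst Y.hom (bcSpec K L) =
      pullback.fst X.hom (bcSpec K L) ≫ g.left := pullback.lift_fst _ _ _
  have hY : Surjective (pullback.fst Y.hom (bcSpec K L)) :=
    MorphismProperty.pullback_fst (P := @Surjective) _ _ (surjective_bcSpec (K := K) L)
  refine ⟨fun y => ?_⟩
  obtain ⟨z, hz⟩ := hY.1 y
  obtain ⟨w, hw⟩ := ‹Surjective ((bcFunctor K L).map g).left›.1 z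
  refine ⟨(pullback.fst X.hom (bcSpec K L)).base w, ?_⟩
  have h := congrArg (fun f => f.base w) hsq
  simp only [Scheme.Hom.comp_base, TopCat.comp_app] at h
  rw [← hz, ← hw]
  exact h.symm

variable {X : SchemeOver K} {A : AbelianVariety K} (φ : X ⟶ A.X)

/-- Base change of the difference map: `(d_φ)_L = δ ≫ d_{φ_L}` through the oplax structure map
`δ : (X × X)_L → X_L × X_L` (re-derived; the copy in ★ `Motives/GeneratesBaseChange` is private).
[cite: Serre1958MorphismesUniversels, no. 1] -/
private theorem bcFunctor_map_diffOf' :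
    (bcFunctor K L).map (diffOf φ) =
      Functor.OplaxMonoidal.δ (bcFunctor K L) X X ≫ diffOf (A := A.baseChange L) ((bcFunctor K L).map φ) := by
  unfold diffOf
  rw [MonObj.comp_mul, GrpObj.comp_inv, Functor.OplaxMonoidal.δ_fst_assoc, Functor.OplaxMonoidal.δ_snd_assoc,
    Functor.map_mul, Functor.map_inv', Functor.map_comp, Functor.map_comp]
  rfl

/-- Base change of the sum maps: `(s_n)_L = e_n ≫ s_n(φ_L)` for the monoidal structure isomorphism
`e_n : ((X × X)ⁿ⁺¹)_L ≅ (X_L × X_L)ⁿ⁺¹` (existential form; re-derived from the private plumbing of ★ `Motives/GeneratesBaseChange`).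
[cite: Serre1958MorphismesUniversels, no. 1] -/
private theorem exists_iso_bcFunctor_map_pmSum : ∀ n : ℕ,
    ∃ e : (bcFunctor K L).obj (pmPow X n) ≅ pmPow ((bcFunctor K L).obj X) n,
      (bcFunctor K L).map (pmSum φ n) = e.hom ≫ pmSum (A := A.baseChange L) ((bcFunctor K L).map φ) n
  | 0 => ⟨(Functor.Monoidal.μIso (bcFunctor K L) X X).symm, by
      rw [Iso.symm_hom, Functor.Monoidal.μIso_inv]
      exact bcFunctor_map_diffOf' L φ⟩
  | n + 1 => by
    obtain ⟨e, he⟩ := exists_iso_bcFunctor_map_pmSum n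
    have hfst : ((Functor.Monoidal.μIso (bcFunctor K L) (pmPow X n) (X ⊗ X)).symm ≪≫
        tensorIso e (Functor.Monoidal.μIso (bcFunctor K L) X X).symm).hom ≫ fst _ _ =
          (bcFunctor K L).map (fst (pmPow X n) (X ⊗ X)) ≫ e.hom := by
      change ((Functor.Monoidal.μIso (bcFunctor K L) (pmPow X n) (X ⊗ X)).inv ≫
        (e.hom ⊗ₘ (Functor.Monoidal.μIso (bcFunctor K L) X X).inv)) ≫ fst _ _ = _
      rw [Category.assoc, tensorHom_fst, Functor.Monoidal.μIso_inv, Functor.OplaxMonoidal.δ_fst_assoc]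
    have hsnd : ((Functor.Monoidal.μIso (bcFunctor K L) (pmPow X n) (X ⊗ X)).symm ≪≫
        tensorIso e (Functor.Monoidal.μIso (bcFunctor K L) X X).symm).hom ≫ snd _ _ =
          (bcFunctor K L).map (snd (pmPow X n) (X ⊗ X)) ≫ Functor.OplaxMonoidal.δ (bcFunctor K L) X X := by
      change ((Functor.Monoidal.μIso (bcFunctor K L) (pmPow X n) (X ⊗ X)).inv ≫
        (e.hom ⊗ₘ (Functor.Monoidal.μIso (bcFunctor K L) X X).inv)) ≫ snd _ _ = _
      rw [Category.assoc, tensorHom_snd, Functor.Monoidal.μIso_inv, Functor.OplaxMonoidal.δ_snd_assoc,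
        Functor.Monoidal.μIso_inv]
    refine ⟨(Functor.Monoidal.μIso (bcFunctor K L) (pmPow X n) (X ⊗ X)).symm ≪≫
      tensorIso e (Functor.Monoidal.μIso (bcFunctor K L) X X).symm, ?_⟩
    rw [pmSum_succ, pmSum_succ, MonObj.comp_mul, reassoc_of% hfst, reassoc_of% hsnd, ← he, ← bcFunctor_map_diffOf',
      Functor.map_mul, Functor.map_comp, Functor.map_comp]
    rfl

/-- **The sum maps of `φ` are surjective where those of `φ_L` are**: `(s_n)_L = e_n ≫ s_n(φ_L)` with `e_n` an isomorphism, and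
surjectivity descends along `((X × X)ⁿ⁺¹)_L → (X × X)ⁿ⁺¹`. [cite: GortzWedhorn2020, Prop. 4.32 (2)] [cite: Serre1958MorphismesUniversels, no. 1] -/
theorem surjective_pmSum_of_surjective_pmSum_baseChange (n : ℕ)
    [h : Surjective (pmSum (A := A.baseChange L) ((bcFunctor K L).map φ) n).left] : Surjective (pmSum φ n).left := by
  obtain ⟨e, he⟩ := exists_iso_bcFunctor_map_pmSum L φ n
  haveI : Surjective ((bcFunctor K L).map (pmSum φ n)).left := by
    rw [he, Over.comp_left]
    haveI : IsIso e.hom.left := ((Over.forget _).mapIso e).isIso_hom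
    exact ⟨h.1.comp e.hom.left.surjective⟩
  exact surjective_of_surjective_bcFunctor_map_left L (pmSum φ n)

/-- **Generation descends along extension of the base field**: if `φ_L : X_L → A_L` generates `A_L` then `φ : X → A` generates `A`
(converse of ★ `Generates.baseChange`; [Lang1983AbelianVarieties] II §3: generation is generic surjectivity of a sum map, which
descends along the faithfully flat `Spec L → Spec K`). [cite: Lang1983AbelianVarieties, II §3 (p. 35)] [cite: GortzWedhorn2020, Prop. 4.32 (2)] -/
theorem Generates.of_baseChange (h : Generates (A := A.baseChange L) ((bcFunctor K L).map φ)) : Generates φ := by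
  obtain ⟨n, hn⟩ := h
  exact ⟨n, surjective_pmSum_of_surjective_pmSum_baseChange L φ n⟩

end Descent

/-! ## §2 Generation from a biproduct of generated pieces (algebraically closed base field) -/

section Charts

variable {Ω : Type} [Field Ω] {N : SchemeOver Ω} {A : AbelianVariety Ω} (φ : N ⟶ A.X)

/-- `s_{n+1}(z, w) = s_n(z) · d(w)` on `T`-points: a value of `s_n` times a value of `d` is a value of `s_{n+1}`.
[cite: Serre1958MorphismesUniversels, no. 1] -/
private theorem exists_comp_pmSum_succ_eq_mul {T : SchemeOver Ω} {n : ℕ} {y y' : T ⟶ A.X}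
    (hy : ∃ t : T ⟶ pmPow N n, t ≫ pmSum φ n = y) (hy' : ∃ t : T ⟶ pmPow N 0, t ≫ pmSum φ 0 = y') :
    ∃ t : T ⟶ pmPow N (n + 1), t ≫ pmSum φ (n + 1) = y * y' := by
  obtain ⟨t, ht⟩ := hy
  obtain ⟨s, hs⟩ := hy'
  exact ⟨lift t s, by rw [pmSum_succ, MonObj.comp_mul, lift_fst_assoc, lift_snd_assoc, ht, ← pmSum_zero, hs]⟩

/-- `s_{n+m+1}(z, w) = s_n(z) · s_m(w)` on `T`-points: products of values of sum maps are values of longer sum maps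
(Serre no. 1: «`W_n + W_m ⊆ W_{n+m}`»). [cite: Serre1958MorphismesUniversels, no. 1] -/
private theorem exists_comp_pmSum_add_eq_mul {T : SchemeOver Ω} :
    ∀ (m : ℕ) {n : ℕ} {y y' : T ⟶ A.X},
      (∃ t : T ⟶ pmPow N n, t ≫ pmSum φ n = y) → (∃ t : T ⟶ pmPow N m, t ≫ pmSum φ m = y') →
        ∃ t : T ⟶ pmPow N (n + m + 1), t ≫ pmSum φ (n + m + 1) = y * y'
  | 0, _, _, _, hy, hy' => exists_comp_pmSum_succ_eq_mul φ hy hy'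
  | m + 1, n, y, y', hy, ⟨t, ht⟩ => by
    have h1 : y' = (t ≫ fst _ _ ≫ pmSum φ m) * (t ≫ snd _ _ ≫ pmSum φ 0) := by
      rw [← ht, pmSum_succ, pmSum_zero, MonObj.comp_mul]
    obtain ⟨s, hs⟩ := exists_comp_pmSum_add_eq_mul m hy ⟨t ≫ fst _ _, rfl⟩
    have h2 := exists_comp_pmSum_succ_eq_mul φ ⟨s, hs⟩ ⟨t ≫ snd _ _, rfl⟩
    rw [h1, ← mul_assoc]
    exact h2

/-- Padding: a value of `s_n` is a value of `s_{n'}` for every `n' ≥ n` (multiply by `d(x, x) = 1` at a `T`-point `x` of `N`).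
[cite: Serre1958MorphismesUniversels, no. 1] -/
private theorem exists_comp_pmSum_of_le {T : SchemeOver Ω} (x : T ⟶ N) {n n' : ℕ} (h : n ≤ n') {y : T ⟶ A.X}
    (hy : ∃ t : T ⟶ pmPow N n, t ≫ pmSum φ n = y) : ∃ t : T ⟶ pmPow N n', t ≫ pmSum φ n' = y := by
  induction h with
  | refl => exact hy
  | step _ ih =>
    have h1 := exists_comp_pmSum_succ_eq_mul φ ih ⟨lift x x, by rw [pmSum_zero, lift_self_diffOf]⟩
    rwa [mul_one] at h1

/-- Chart transfer: if `l ≫ φ = ψ ≫ ι` then `ι` of a value of `s_n(ψ)` is a value of `s_n(φ)` (★ `exists_comp_pmSum_eq`, ★ `pmSum_comp`).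
[cite: Serre1958MorphismesUniversels, no. 1] -/
private theorem exists_comp_pmSum_eq_comp_of_chart {S : SchemeOver Ω} {J : AbelianVariety Ω} (l : S ⟶ N) (ψ : S ⟶ J.X)
    (inc : J ⟶ A) (hl : l ≫ φ = ψ ≫ inc.hom.hom.hom) {T : SchemeOver Ω} {n : ℕ} {y : T ⟶ J.X}
    (hy : ∃ t : T ⟶ pmPow S n, t ≫ pmSum ψ n = y) :
    ∃ t : T ⟶ pmPow N n, t ≫ pmSum φ n = y ≫ inc.hom.hom.hom := by
  obtain ⟨t, ht⟩ := hy
  obtain ⟨G, hG⟩ := exists_comp_pmSum_eq l φ n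
  refine ⟨t ≫ G, ?_⟩
  rw [Category.assoc, hG, hl, pmSum_comp ψ inc n, ← Category.assoc, ht]

/-- Finite products of values of sum maps are values of a sum map (of length the sum of the lengths).
[cite: Serre1958MorphismesUniversels, no. 1] -/
private theorem exists_comp_pmSum_eq_prod {C : Type} [DecidableEq C] (s : Finset C) (n : C → ℕ) {T : SchemeOver Ω}
    (x : T ⟶ N) (y : C → (T ⟶ A.X)) (hy : ∀ c ∈ s, ∃ t : T ⟶ pmPow N (n c), t ≫ pmSum φ (n c) = y c) :
    ∃ t : T ⟶ pmPow N (∑ c ∈ s, (n c + 1)), t ≫ pmSum φ (∑ c ∈ s, (n c + 1)) = ∏ c ∈ s, y c := by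
  induction s using Finset.induction_on with
  | empty =>
    rw [Finset.sum_empty, Finset.prod_empty]
    exact ⟨lift x x, by rw [pmSum_zero, lift_self_diffOf]⟩
  | insert a s ha ih =>
    rw [Finset.sum_insert ha, Finset.prod_insert ha]
    have h1 := exists_comp_pmSum_add_eq_mul φ (∑ c ∈ s, (n c + 1)) (hy a (Finset.mem_insert_self a s))
      (ih fun c hc => hy c (Finset.mem_insert_of_mem hc))
    have e : n a + ∑ c ∈ s, (n c + 1) + 1 = n a + 1 + ∑ c ∈ s, (n c + 1) := by ring
    rw [e] at h1
    exact h1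

/-- The `(n+1)`-fold sum scheme `(N × N)ⁿ⁺¹` is proper over the base when `N` is. [folklore] -/
private theorem isProper_pmPow_hom' [IsProper N.hom] : ∀ n : ℕ, IsProper (pmPow N n).hom
  | 0 => isProper_tensorObj_hom N N
  | n + 1 => by
    haveI := isProper_pmPow_hom' n
    exact isProper_tensorObj_hom (pmPow N n) (N ⊗ N)

/-- A point followed by a finite sum of homomorphisms is the product of the composites. [folklore] -/
private theorem comp_sum_hom_hom_hom {T : SchemeOver Ω} {B B' : AbelianVariety Ω} (x : T ⟶ B.X) {C : Type} (s : Finset C)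
    (f : C → (B ⟶ B')) : x ≫ (∑ c ∈ s, f c).hom.hom.hom = ∏ c ∈ s, x ≫ (f c).hom.hom.hom := by
  classical
  induction s using Finset.induction_on with
  | empty =>
    rw [Finset.sum_empty, Finset.prod_empty]
    exact MonObj.comp_one x
  | insert a s ha ih =>
    rw [Finset.sum_insert ha, Finset.prod_insert ha, AbelianVariety.hom_hom_hom_add, MonObj.comp_mul, ih]

variable [IsAlgClosed Ω]

/-- **Generation from a finite biproduct of generated pieces** (algebraically closed base field `Ω`).  Let `φ : N → A` be a
morphism from a proper `Ω`-scheme with an `Ω`-point to an abelian variety carrying a finite biproduct structure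
`π_c : A → J_c`, `ι_c : J_c → A`, `∑_c π_c ≫ ι_c = 𝟙`, and let `l_c : S_c → N` (all `S_c` proper) be charts with
`l_c ≫ φ = ψ_c ≫ ι_c` for morphisms `ψ_c : S_c → J_c` each of which GENERATES `J_c`.  Then `φ` generates `A`: every `Ω`-point
`x = ∏_c ι_c(π_c x)` of `A` is a product of values of sum maps of the `ψ_c` pushed into `A`, hence a value of one sum map `s_M(φ)`
(`M = ∑_c (n_c + 1)`), and a proper morphism onto whose image every `Ω`-point lifts is surjective
(★ `SchemeOver.surjective_left_of_forall_algPoints`).  This is the step «`Alb_{X'} = ∏ᵢ Alb_{Xᵢ}`» of [Liu2021] §2.1 read for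
generation. [cite: Liu2021, §2.1 proof of the Proposition (FJcycle.tex l. 1194–1200)] [cite: Serre1958MorphismesUniversels, no. 1 Déf. 1]
[cite: Lang1983AbelianVarieties, II §3 (p. 35)] -/
theorem generates_of_biproduct_charts [IsProper N.hom] (hN : Nonempty (AlgPoints N Ω)) {C : Type} [Fintype C]
    (J : C → AbelianVariety Ω) (pr : ∀ c, A ⟶ J c) (inc : ∀ c, J c ⟶ A) (hsum : ∑ c, pr c ≫ inc c = 𝟙 A)
    (S : C → SchemeOver Ω) [∀ c, IsProper (S c).hom] (l : ∀ c, S c ⟶ N) (ψ : ∀ c, S c ⟶ (J c).X)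
    (hl : ∀ c, l c ≫ φ = ψ c ≫ (inc c).hom.hom.hom) (hψ : ∀ c, Generates (ψ c)) : Generates φ := by
  classical
  obtain ⟨x₀⟩ := hN
  -- lengths of surjective sum maps of the pieces
  choose n hn using hψ
  refine ⟨∑ c, (n c + 1), ?_⟩
  haveI : IsProper (pmPow N (∑ c, (n c + 1))).hom := isProper_pmPow_hom' _
  refine SchemeOver.surjective_left_of_forall_algPoints Ω (pmSum φ (∑ c, (n c + 1))) fun x => ?_
  -- `x = ∏_c (x ≫ pr_c) ≫ inc_c`
  have hx : x = ∏ c, (x ≫ (pr c).hom.hom.hom) ≫ (inc c).hom.hom.hom := by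
    have h := comp_sum_hom_hom_hom x Finset.univ (fun c => pr c ≫ inc c)
    rw [hsum] at h
    simpa using h
  -- each factor is a value of `s_{n_c}(φ)`
  have hfac : ∀ c ∈ (Finset.univ : Finset C), ∃ t : specOver Ω Ω ⟶ pmPow N (n c),
      t ≫ pmSum φ (n c) = (x ≫ (pr c).hom.hom.hom) ≫ (inc c).hom.hom.hom := by
    intro c _
    haveI := hn c
    haveI : IsProper (pmPow (S c) (n c)).hom := isProper_pmPow_hom' _
    obtain ⟨t, ht⟩ := AlgPoints.exists_comp_eq_of_surjective (pmSum (ψ c) (n c)) (x ≫ (pr c).hom.hom.hom)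
    exact exists_comp_pmSum_eq_comp_of_chart φ (l c) (ψ c) (inc c) (hl c) ⟨t, ht⟩
  obtain ⟨t, ht⟩ := exists_comp_pmSum_eq_prod φ Finset.univ n (x₀ ≫ 𝟙 N)
    (fun c => (x ≫ (pr c).hom.hom.hom) ≫ (inc c).hom.hom.hom) hfac
  exact ⟨t, by rw [ht, ← hx]⟩

end Charts

/-! ### Nonemptiness and properness through base change (bookkeeping) -/

section Bookkeeping

variable {K : Type u} [Field K] (L : Type u) [Field L] [Algebra K L]

/-- `Y_L` is non-empty when `Y` is (the projection `Y_L → Y` is surjective). [cite: GortzWedhorn2020, Prop. 4.32 (2)] -/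
theorem nonempty_bcFunctor_obj_left (Y : SchemeOver K) [h : Nonempty Y.left] : Nonempty ((bcFunctor K L).obj Y).left := by
  obtain ⟨y⟩ := h
  have hY : Surjective (pullback.fst Y.hom (bcSpec K L)) :=
    MorphismProperty.pullback_fst (P := @Surjective) _ _ (surjective_bcSpec (K := K) L)
  obtain ⟨z, _⟩ := hY.1 y
  exact ⟨z⟩

/-- `Y_L → Spec L` is proper when `Y → Spec K` is. [cite: GortzWedhorn2020, Prop. 4.32 (2)] -/
theorem isProper_bcFunctor_obj_hom (Y : SchemeOver K) [IsProper Y.hom] : IsProper ((bcFunctor K L).obj Y).hom := by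
  change IsProper (pullback.snd Y.hom (bcSpec K L))
  infer_instance

end Bookkeeping

end Literature.AlgebraicGeometry.Motives

/-! ## §3 The Albanese morphism generates -/

namespace Literature.NumberTheory.Automorphic.Liu2021.AppendixC

open Literature.AlgebraicGeometry.Motives
open AbelianVariety (bcSpec bcFunctor)
open scoped MonObj

/-- The difference map `diff : E × E → J(E)` of a Jacobian datum of a proper geometrically integral POINTED `E` generates
`J(E)` (Milne's ★ `Jacobian.generates_abelJacobi`: `f^P = (𝟙, P) ≫ diff` generates, and generation passes to `diff`,
★ `Generates.of_comp`). [cite: Milne1986JacobianVarieties, §6 Prop. 6.1 (proof) and Prop. 6.4] [cite: Serre1958MorphismesUniversels, no. 2 Thm. 1–2] -/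
theorem _root_.Literature.AlgebraicGeometry.Motives.Jacobian.generates_diff {k : Type u} [Field k] {E : SchemeOver k}
    [IsProper E.hom] [GeometricallyIntegral E.hom] (𝒥 : Jacobian E) (P : AlgPoints E k) : Generates 𝒥.diff := by
  have h := 𝒥.generates_abelJacobi P
  unfold Jacobian.abelJacobi at h
  exact Generates.of_comp _ h

/-- `∇X` is proper over `k` for `X` proper (closed in `X × X`). [cite: Liu2021, §2.1 Def. 2.1 (1) (FJcycle.tex l. 1171–1174)] -/
theorem Nabla.isProper_hom {k : Type u} [Field k] {X : SchemeOver k} [IsProper X.hom] (N : Nabla X) : IsProper N.N.hom := by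
  haveI := N.isClosedImmersion_incl
  haveI := isProper_tensorObj_hom X X
  rw [← Over.w N.incl]
  infer_instance

/-- `∇X` is non-empty for `X` non-empty (the diagonal). [cite: Liu2021, §2.1 Def. 2.1 (1) (FJcycle.tex l. 1171–1174)] -/
theorem Nabla.nonempty_left {k : Type u} [Field k] {X : SchemeOver k} [h : Nonempty X.left] (N : Nabla X) : Nonempty N.N.left := by
  obtain ⟨x⟩ := h
  exact ⟨N.diag.left.base x⟩

/-- **The Albanese morphism `α_X : ∇X → Alb_X` GENERATES `Alb_X`** ([Liu2021] §2.1, Def. 2.3 with the proof of the Proposition,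
l. 1194–1200; generation in the sense of Serre no. 1 Déf. 1 / Lang II §3: some sum map `((z_i, z'_i))_i ↦ ∏ α(z_i) α(z'_i)⁻¹`,
`(∇X × ∇X)ⁿ⁺¹ → Alb_X`, is surjective).  For `X` smooth of some relative dimension and projective over a field `k` of
characteristic zero with `[Algebra k ℂ]`, `X` non-empty, and ANY Albanese datum `a` (corepresentability typing ★ `AppendixC.Albanese`).
Proof: over a finite Galois splitting field `L`, `(Alb_X)_L ≅ ⊕_c J(E_c)` compatibly with `α` (★
`Albanese.exists_isGalois_isLimit_fan_baseChange_compat`: pointed pieces `E_c`, charts `E_c × E_c → (∇X)_L` along which `(α_X)_L` is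
`diff_c ≫ ι_c`); each `diff_c` generates (`Jacobian.generates_diff`); over `Ω = L̄` the charts assemble to generation of `((α_X)_L)_Ω`
(`generates_of_biproduct_charts`); generation descends `Ω → L → k` (`Generates.of_baseChange`).  Use (F0P5a pole, T4): with ★
`AbelianScheme.generates_fibre_of_generates_fibre_of_injective`, generation spreads from the generic fibre `M⋆_K` of the smooth model to the
special fibre. [cite: Liu2021, §2.1 Proposition (FJcycle.tex l. 1190–1192) with proof (l. 1194–1200), Def. 2.3 (l. 1202–1208)]
[cite: Serre1958MorphismesUniversels, no. 1 Déf. 1 and no. 2 Thm. 1–2] [cite: Lang1983AbelianVarieties, II §3 (p. 35)]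
[cite: Milne1986JacobianVarieties, §6 Prop. 6.1 (proof), Prop. 6.4, Remark 6.5] -/
theorem Albanese.generates_α {k : Type} [Field k] [CharZero k] [Algebra k ℂ] {d : ℕ} (X : SchemeOver k)
    [SmoothOfRelativeDimension d X.hom] (hX : IsProjectiveOver X) [Nonempty X.left] (a : Albanese X) :
    Generates a.α := by
  obtain ⟨L, _, _, _, _, C, _, E, e, hE, _, P, 𝒥, pr, inc, l, _, _, _, hsum, _, hlα⟩ :=
    Albanese.exists_isGalois_isLimit_fan_baseChange_compat (d := d) X hX a
  -- instances: properness and non-emptiness of the carriers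
  haveI : IsProper X.hom := hX.isProper
  haveI : IsProper a.nabla.N.hom := a.nabla.isProper_hom
  haveI : Nonempty a.nabla.N.left := a.nabla.nonempty_left
  let Ω : Type := AlgebraicClosure L
  haveI : IsProper ((bcFunctor k L).obj a.nabla.N).hom := isProper_bcFunctor_obj_hom L _
  haveI : Nonempty ((bcFunctor k L).obj a.nabla.N).left := nonempty_bcFunctor_obj_left L _
  -- the data over `Ω = L̄`
  let N' : SchemeOver Ω := (bcFunctor L Ω).obj ((bcFunctor k L).obj a.nabla.N)
  let A' : AbelianVariety Ω := (a.Alb.baseChange L).baseChange Ω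
  let φ' : N' ⟶ A'.X := (bcFunctor L Ω).map ((bcFunctor k L).map a.α)
  haveI : IsProper N'.hom := isProper_bcFunctor_obj_hom Ω _
  haveI : Nonempty N'.left := nonempty_bcFunctor_obj_left Ω _
  have hN' : Nonempty (AlgPoints N' Ω) := AlgPoints.nonempty_of_locallyOfFiniteType N' Ω
  haveI : ∀ c, IsProper (E c).hom := fun c => (hE c).isProjectiveOver.isProper
  haveI : ∀ c, GeometricallyIntegral (E c).hom := fun c => IsSmoothProjective.geometricallyIntegral_holds (hE c)
  haveI : ∀ c, IsProper (E c ⊗ E c).hom := fun c => isProper_tensorObj_hom (E c) (E c)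
  let J' : C → AbelianVariety Ω := fun c => (𝒥 c).J.baseChange Ω
  let pr' : ∀ c, A' ⟶ J' c := fun c => AbelianVariety.Hom.baseChange Ω (pr c)
  let inc' : ∀ c, J' c ⟶ A' := fun c => AbelianVariety.Hom.baseChange Ω (inc c)
  let S' : C → SchemeOver Ω := fun c => (bcFunctor L Ω).obj (E c ⊗ E c)
  haveI : ∀ c, IsProper (S' c).hom := fun c => isProper_bcFunctor_obj_hom Ω _
  let l' : ∀ c, S' c ⟶ N' := fun c => (bcFunctor L Ω).map (l c)
  let ψ' : ∀ c, S' c ⟶ (J' c).X := fun c => (bcFunctor L Ω).map (𝒥 c).diff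
  -- `∑_c pr_c ≫ inc_c = 𝟙`, base-changed (the base-change functor is additive)
  have hsum' : ∑ c, pr' c ≫ inc' c = 𝟙 A' := by
    have h := congrArg (fun f => (AbelianVariety.baseChangeFunctor L Ω).map f) hsum
    simp only [Functor.map_sum, Functor.map_comp] at h
    rw [show (AbelianVariety.baseChangeFunctor L Ω).map (𝟙 (a.Alb.baseChange L)) = 𝟙 A' from
      AbelianVariety.Hom.baseChange_id Ω _] at h
    exact h
  -- the charts `l_c ≫ (α)_L = diff_c ≫ ι_c`, base-changed
  have hl' : ∀ c, l' c ≫ φ' = ψ' c ≫ (inc' c).hom.hom.hom := by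
    intro c
    have h := congrArg (fun f => (bcFunctor L Ω).map f) (hlα c)
    dsimp only at h
    exact ((bcFunctor L Ω).map_comp _ _).symm.trans (h.trans ((bcFunctor L Ω).map_comp _ _))
  -- each `diff_c` generates, hence so does its base change
  have hψ' : ∀ c, Generates (ψ' c) := fun c => ((𝒥 c).generates_diff (P c)).baseChange Ω
  -- generation over `Ω` from the biproduct of the Jacobians of the pieces
  have hΩ : Generates φ' := generates_of_biproduct_charts φ' hN' J' pr' inc' hsum' S' l' ψ' hl' hψ'
  -- descent `Ω → L → k`
  have hL : Generates (A := a.Alb.baseChange L) ((bcFunctor k L).map a.α) :=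
    Generates.of_baseChange (A := a.Alb.baseChange L) Ω ((bcFunctor k L).map a.α) hΩ
  exact Generates.of_baseChange (A := a.Alb) L a.α hL

end Literature.NumberTheory.Automorphic.Liu2021.AppendixC

end
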